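import Summits.MatrixMultiplication.MatrixMultiplication.Theses.AssociativePencil
import Summits.MatrixMultiplication.MatrixMultiplication.Theorems.AssociativePencilLagrangeNodeBound
import Summits.MatrixMultiplication.MatrixMultiplication.Theorems.AssociativePencilRankBoundToOmega

/-!
# `AssociativePencil.TameNodeCurves` (stmt-MatrixMultiplication-7189) — census evidence (sandwich + linearity)

Route `MatrixMultiplication/AssociativePencil`, deciding crux `TameNodeCurves` (TNC). Kernel-checked facts
used by the crux-strategist's STRATEGY-CENSUS (re-audit of the RESTATED bin, 2026-08-17); the file is a
helper (`--supports stmt-MatrixMultiplication-7189`), it closes nothing.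

* `matMulTensor_coord_assoc` — the coordinate associativity identity of `⟨n,n,n⟩` in the exact shape of
  the route's associativity clause (`((E_x E_y) E_z)_w = (E_x (E_y E_z))_w`).
* `tameNodeCurves_of_rankLinear` — **RankLinear ⟹ TNC**: if `R(⟨n,n,n⟩) ≤ C·n²` for infinitely many
  `n ≥ 2`, then `TameNodeCurves` holds via the degree-`0` family `F(t) = ⟨n,n,n⟩` (one node). Together with
  the route's deciding theorem (`closes` + the proved supports) this sandwiches the crux between two open
  statements: `RankLinear ⟹ TameNodeCurves ⟹ ω(ℂ) = 2` (`matrixMultiplication_of_tameNodeCurves`,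
  `matrixMultiplication_of_rankLinear`). Consequence recorded in the census: a REFUTATION of TNC is a proof
  that `R(⟨n,n,n⟩)/n² → ∞`, i.e. a super-linear rank lower bound for matrix multiplication
  (LinearRankMethodBarrier), and a PROOF of TNC proves the summit.
* `coeff_eq_zero_of_nodeValues` — **Lagrange linearity**: every coefficient `ν_j` of a polynomial family is a
  `ℂ`-linear combination of the node values `F(t_i)` (Vandermonde inversion, from
  `coeff_eq_sum_vandermonde_inv_smul_nodeValue`), so every `ℂ`-linear condition satisfied by all node values
  is satisfied by every coefficient, in particular by the top coefficient `⟨n,n,n⟩`.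
* `no_commutative_nodes` — corollary: for `n ≥ 2` no family with top coefficient `⟨n,n,n⟩` has all its
  `s + 1` node values commutative (the census uses this to kill every node class cut out by LINEAR
  conditions: commutative nodes, nodes sparse in a FIXED basis, nodes satisfying a linear identity).
-/

-- Single-conjunct summit: `Summit.MatrixMultiplication.MatrixMultiplication.…` repeats the name by design (D-0017).
set_option linter.dupNamespace false

namespace Summit.MatrixMultiplication.MatrixMultiplication.Theorems

open scoped BigOperators Matrix
open Literature.Computability.AlgebraicComplexity
open Summit.MatrixMultiplication.MatrixMultiplication.Theses.AssociativePencil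

/-- **Coordinate associativity of `⟨n,n,n⟩`.** With `μ = matMulTensor ℂ n n n` read as structure
constants (`μ z x y` = coefficient of `E_z` in `E_x E_y`), `∑_u μ u x y · μ w u z = ∑_v μ v y z · μ w x v`,
i.e. `((E_x E_y) E_z)_w = (E_x (E_y E_z))_w`; both sides equal
`[x₂ = y₁][y₂ = z₁][w₁ = x₁][w₂ = z₂]`. [folklore] -/
theorem matMulTensor_coord_assoc (n : ℕ) (x y z w : Fin n × Fin n) :
    ∑ u, matMulTensor ℂ n n n u x y * matMulTensor ℂ n n n w u z =
      ∑ v, matMulTensor ℂ n n n v y z * matMulTensor ℂ n n n w x v := by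
  classical
  obtain ⟨x₁, x₂⟩ := x
  obtain ⟨y₁, y₂⟩ := y
  obtain ⟨z₁, z₂⟩ := z
  obtain ⟨w₁, w₂⟩ := w
  have hL : ∑ u, matMulTensor ℂ n n n u (x₁, x₂) (y₁, y₂) * matMulTensor ℂ n n n (w₁, w₂) u (z₁, z₂) =
      if x₂ = y₁ ∧ y₂ = z₁ ∧ w₁ = x₁ ∧ w₂ = z₂ then 1 else 0 := by
    rw [Finset.sum_eq_single (x₁, y₂)]
    · by_cases h₁ : x₂ = y₁ <;> by_cases h₂ : y₂ = z₁ <;> by_cases h₃ : w₁ = x₁ <;>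
        by_cases h₄ : w₂ = z₂ <;> simp [matMulTensor, h₁, h₂, h₃, h₄]
    · rintro ⟨u₁, u₂⟩ - hu
      have hu' : ¬ (u₁ = x₁ ∧ x₂ = y₁ ∧ u₂ = y₂) := fun h => hu (Prod.ext h.1 h.2.2)
      simp [matMulTensor, hu']
    · intro h
      exact absurd (Finset.mem_univ _) h
  have hR : ∑ v, matMulTensor ℂ n n n v (y₁, y₂) (z₁, z₂) * matMulTensor ℂ n n n (w₁, w₂) (x₁, x₂) v =
      if x₂ = y₁ ∧ y₂ = z₁ ∧ w₁ = x₁ ∧ w₂ = z₂ then 1 else 0 := by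
    rw [Finset.sum_eq_single (y₁, z₂)]
    · by_cases h₁ : x₂ = y₁ <;> by_cases h₂ : y₂ = z₁ <;> by_cases h₃ : w₁ = x₁ <;>
        by_cases h₄ : w₂ = z₂ <;> simp [matMulTensor, h₁, h₂, h₃, h₄]
    · rintro ⟨v₁, v₂⟩ - hv
      have hv' : ¬ (v₁ = y₁ ∧ y₂ = z₁ ∧ v₂ = z₂) := fun h => hv (Prod.ext h.1 h.2.2)
      simp [matMulTensor, hv']
    · intro h
      exact absurd (Finset.mem_univ _) h
  rw [hL, hR]

/-- **RankLinear ⟹ TameNodeCurves.** If for some `C > 0` and infinitely many `n ≥ 2` the exact rank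
satisfies `R(⟨n,n,n⟩) ≤ C·n²`, then the route's deciding crux holds: take `s = 0`, the constant family
`F(t) = ⟨n,n,n⟩` (associative for every `t`), and one node `t₀ = 0`, whose fibre is `⟨n,n,n⟩` itself.
Hence `¬ TameNodeCurves` is a super-linear lower bound `R(⟨n,n,n⟩) ≠ O(n²)` along all large `n`.
[folklore] -/
theorem tameNodeCurves_of_rankLinear
    (h : ∃ C : ℝ, 0 < C ∧ ∀ n₀ : ℕ, ∃ n : ℕ, n₀ ≤ n ∧ 2 ≤ n ∧
      (tensorRank (matMulTensor ℂ n n n) : ℝ) ≤ C * (n : ℝ) ^ 2) :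
    TameNodeCurves := by
  intro ε hε
  obtain ⟨C, hC, hio⟩ := h
  refine ⟨C, hC, fun n₀ => ?_⟩
  obtain ⟨n, hn₀, h2, hR⟩ := hio n₀
  refine ⟨n, hn₀, h2, 0, ?_, fun _ => matMulTensor ℂ n n n, rfl, ?_, fun _ => 0,
    fun a b _ => Fin.ext (by have ha := a.isLt; have hb := b.isLt; omega), ?_⟩
  · -- `0 + 1 ≤ n ^ ε`
    have hn1 : (1 : ℝ) ≤ n := by exact_mod_cast le_trans one_le_two h2
    simpa using Real.one_le_rpow hn1 hε.le
  · -- the constant family is associative: this is associativity of `⟨n,n,n⟩`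
    intro t x y z w
    simp only [Fin.sum_univ_succ, Fin.sum_univ_zero, add_zero, Fin.val_zero, pow_zero, one_mul]
    exact matMulTensor_coord_assoc n x y z w
  · -- the single node is `⟨n,n,n⟩` itself
    intro i
    simp only [Fin.sum_univ_succ, Fin.sum_univ_zero, add_zero, Fin.val_zero, pow_zero, one_mul]
    exact hR

/-- **`TameNodeCurves` alone decides the summit** (the one-crux shape of the route, made explicit): the
deciding theorem `closes` with its two proved supports `lagrangeNodeBound_proof`, `rankBoundToOmega_proof`.
Conditional on the open crux; closes nothing. [folklore] -/
theorem matrixMultiplication_of_tameNodeCurves (hT : TameNodeCurves) : _root_.MatrixMultiplication :=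
  closes lagrangeNodeBound_proof rankBoundToOmega_proof hT

/-- **RankLinear ⟹ ω(ℂ) = 2 through the route** (sandwich `RankLinear ⟹ TameNodeCurves ⟹ ω = 2`).
Conditional; closes nothing. [folklore] -/
theorem matrixMultiplication_of_rankLinear
    (h : ∃ C : ℝ, 0 < C ∧ ∀ n₀ : ℕ, ∃ n : ℕ, n₀ ≤ n ∧ 2 ≤ n ∧
      (tensorRank (matMulTensor ℂ n n n) : ℝ) ≤ C * (n : ℝ) ^ 2) :
    _root_.MatrixMultiplication :=
  matrixMultiplication_of_tameNodeCurves (tameNodeCurves_of_rankLinear h)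

/-- **Lagrange linearity.** For pairwise distinct nodes, every coefficient `ν j` of the family
`F(t) = ∑ⱼ tʲ νⱼ` is a `ℂ`-linear combination of the node values `F(node i)` (Vandermonde inversion), so a
`ℂ`-linear map that kills every node value kills every coefficient. [folklore] -/
theorem coeff_eq_zero_of_nodeValues {n s : ℕ} {M : Type*} [AddCommGroup M] [Module ℂ M]
    (φ : (Fin n × Fin n → Fin n × Fin n → Fin n × Fin n → ℂ) →ₗ[ℂ] M)
    (ν : Fin (s + 1) → (Fin n × Fin n → Fin n × Fin n → Fin n × Fin n → ℂ))
    (node : Fin (s + 1) → ℂ) (hnode : Function.Injective node)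
    (hφ : ∀ i, φ (fun z x y => ∑ j : Fin (s + 1), node i ^ (j : ℕ) * ν j z x y) = 0)
    (j : Fin (s + 1)) : φ (ν j) = 0 := by
  have hkey : ν j = ∑ i, (Matrix.vandermonde node)⁻¹ j i •
      (fun z x y => ∑ k : Fin (s + 1), node i ^ (k : ℕ) * ν k z x y) := by
    funext z x y
    have h := congrFun (coeff_eq_sum_vandermonde_inv_smul_nodeValue
      (fun k (p : (Fin n × Fin n) × (Fin n × Fin n) × (Fin n × Fin n)) => ν k p.1 p.2.1 p.2.2)
      node hnode j) (z, x, y)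
    simp only [Finset.sum_apply, Pi.smul_apply, smul_eq_mul] at h ⊢
    simpa using h
  rw [hkey, map_sum]
  simp [map_smul, hφ]

/-- **No commutative node configurations.** For `n ≥ 2`, a polynomial family on `ℂ^{n×n}` with top
coefficient `⟨n,n,n⟩` cannot have all its `s + 1` (distinct) node values commutative: by Lagrange
linearity `⟨n,n,n⟩` would be commutative, but `E₀₀ E₀₁ = E₀₁ ≠ 0 = E₀₁ E₀₀`. The same argument refutes
every node class cut out by `ℂ`-linear conditions on the product. [folklore] -/
theorem no_commutative_nodes {n s : ℕ} (hn : 2 ≤ n)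
    (ν : Fin (s + 1) → (Fin n × Fin n → Fin n × Fin n → Fin n × Fin n → ℂ))
    (hνs : ν (Fin.last s) = matMulTensor ℂ n n n)
    (node : Fin (s + 1) → ℂ) (hnode : Function.Injective node)
    (hcomm : ∀ i, ∀ z x y : Fin n × Fin n, (∑ j : Fin (s + 1), node i ^ (j : ℕ) * ν j z x y) =
      ∑ j : Fin (s + 1), node i ^ (j : ℕ) * ν j z y x) : False := by
  have h0 : 0 < n := by omega
  have h1 : 1 < n := by omega
  set i0 : Fin n := ⟨0, h0⟩ with hi0
  set i1 : Fin n := ⟨1, h1⟩ with hi1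
  have h01 : i0 ≠ i1 := by simp [hi0, hi1, Fin.ext_iff]
  -- the linear functional `β ↦ β_{E₀₁}(E₀₀, E₀₁) - β_{E₀₁}(E₀₁, E₀₀)`
  let φ : (Fin n × Fin n → Fin n × Fin n → Fin n × Fin n → ℂ) →ₗ[ℂ] ℂ :=
    { toFun := fun β => β (i0, i1) (i0, i0) (i0, i1) - β (i0, i1) (i0, i1) (i0, i0)
      map_add' := by
        intro a b
        simp only [Pi.add_apply]
        ring
      map_smul' := by
        intro c a
        simp only [Pi.smul_apply, smul_eq_mul, RingHom.id_apply]
        ring }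
  have hφ : ∀ i, φ (fun z x y => ∑ j : Fin (s + 1), node i ^ (j : ℕ) * ν j z x y) = 0 := by
    intro i
    show (∑ j : Fin (s + 1), node i ^ (j : ℕ) * ν j (i0, i1) (i0, i0) (i0, i1)) -
      (∑ j : Fin (s + 1), node i ^ (j : ℕ) * ν j (i0, i1) (i0, i1) (i0, i0)) = 0
    rw [hcomm i, sub_self]
  have h := coeff_eq_zero_of_nodeValues φ ν node hnode hφ (Fin.last s)
  rw [hνs] at h
  change matMulTensor ℂ n n n (i0, i1) (i0, i0) (i0, i1) -
    matMulTensor ℂ n n n (i0, i1) (i0, i1) (i0, i0) = 0 at h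
  simp [matMulTensor, h01.symm] at h

end Summit.MatrixMultiplication.MatrixMultiplication.Theorems
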